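import Summits.AtomisticToContinuum.HydrodynamicLimit.Theorems.OneFlightGossipEngineClampedCurrentsDockKineticInstance
import HarnessLib

/-!
# KC1 with an explicit `1/K` tilt law (registered sub-goal `tailRate_explicitKineticInstance`, stub `stub_tailRateWindowClause`,
# line `tail-rate`, crux `TwoClocks.TransferEntropyClock`, stmt-AtomisticToContinuum-16625)

Helper file 2/4 (`--supports stmt-AtomisticToContinuum-16625`) of the stub `stub_tailRateWindowClause : TailRateWindowClause`:
the kinetic instance KC1 of the shared heart (landed `ClampedCurrentsDockKineticInstance.stub_kineticInstance`, crux 14680: KCWF +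
cut-off family ⇒ window LD for the class member "traceless stress + low heat flux" along a slab family, threshold `β₀(K⋆)` unknown)
RE-RUN with the line's EXPLICIT kinetic node `KineticLDExplicitFamily` (tilt radius `β₁` before the weights, bound for `|β| ≤ β₁/C`)
and the QUANTITATIVE cut-off `CutoffQuant` of helper file 1/4 (growth constant `2Bb(2+2U²)K + C₂`, remainder controlled at every
rate), both taken as HYPOTHESES (their `def`s re-declared verbatim so that this file imports only built modules): the output
`ExplicitKineticInstance` has `∃ κ > 0, ∃ Cg > 0` BEFORE the level and the LD bound for all `|β| ≤ κ/(Cg K)` — the `1/K` law — together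
with the remainder clauses of the cut-off read on the slab. Same clamp, same class member, same toolkit as the landed KC1
(proof adapted verbatim, attributed). prover-line-stmt-AtomisticToContinuum-16625-c5-0 (stub worker `stub_tailRateWindowClause`).
-/

noncomputable section

open MeasureTheory Filter Set Topology
open scoped ENNReal

namespace Summit.AtomisticToContinuum.HydrodynamicLimit.Theorems.TransferEntropyClockTailRateKinetic

open Literature.MathematicalPhysics.KineticTheory Literature.Analysis.FluidPDE Literature.Analysis.FunctionSpaces
open Summit.AtomisticToContinuum.HydrodynamicLimit.Theorems.ClampedCurrentsDockKineticInstance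
  (quad_growth member_orth continuous_clamp continuousOn_partialDeriv_slab exists_abs_le_slab exists_pos_le_slab
    norm_le_three_mul trace_free traceless_form)

/-! ## §1 Statements (the two hypotheses re-declared verbatim; the registered sub-goal) -/

/-- registered sub-goal signature `tailRate_cutoffQuant` of line tail-rate, crux TransferEntropyClock (stmt-AtomisticToContinuum-16625):
**the quantitative low-speed heat-flux cut-off over a first-countable parameter space** — for a continuous `θ : X → ℝ` with
`0 < θ ≤ θM`, fields `u b : X → V3` with `‖u‖ ≤ U`, `‖b‖ ≤ Bb`: there is `C₂ ≥ 0` and, for every rate `A > 0`, an amplitude `Cρ ≥ 0`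
such that for every level `K ≥ 1` there is a continuous profile `G(p, s)`, bounded on `s ≥ 0`, with (i) remainder
`|s − 5θ(p) − G(p,s)| ≤ Cρ e^{-AK}` for `0 ≤ s ≤ K²` and `≤ |s − 5θ(p)| + Cρ e^{-AK}` for `s > K²`; (ii) `(b(p)·w) G(p,|w|²)`,
`w = v − u(p)`, of quadratic growth `2Bb(2+2U²)·K + C₂` — LINEAR in `K`; (iii) orthogonal to `1, v_k, ‖v‖²` under `M_{1,u(p),θ(p)}`
at every `p` — route-internal, not a cited fact -/
def CutoffQuant : Prop :=
  ∀ {X : Type} [TopologicalSpace X] [FirstCountableTopology X] {θ : X → ℝ}, Continuous θ → ∀ (u b : X → V3) {θM U Bb : ℝ},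
    (∀ p, 0 < θ p) → 0 < θM → (∀ p, θ p ≤ θM) → (∀ p, ‖u p‖ ≤ U) → 0 ≤ Bb → (∀ p, ‖b p‖ ≤ Bb) →
    ∃ C₂ : ℝ, 0 ≤ C₂ ∧ ∀ A : ℝ, 0 < A → ∃ Cρ : ℝ, 0 ≤ Cρ ∧ ∀ K : ℝ, 1 ≤ K →
    ∃ G : X × ℝ → ℝ, Continuous G ∧
      (∃ C : ℝ, ∀ y : X × ℝ, 0 ≤ y.2 → |G y| ≤ C) ∧
      (∀ (p : X) (s : ℝ), 0 ≤ s → s ≤ K ^ 2 → |s - 5 * θ p - G (p, s)| ≤ Cρ * Real.exp (-(A * K))) ∧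
      (∀ (p : X) (s : ℝ), K ^ 2 < s → |s - 5 * θ p - G (p, s)| ≤ |s - 5 * θ p| + Cρ * Real.exp (-(A * K))) ∧
      (∀ (p : X) (v : V3), |(∑ j : Fin 3, b p j * (v - u p) j) * G (p, ‖v - u p‖ ^ 2)| ≤
        (2 * Bb * (2 + 2 * U ^ 2) * K + C₂) * (1 + ‖v‖ ^ 2)) ∧
      (∀ p, ∫ v, ((∑ j : Fin 3, b p j * (v - u p) j) * G (p, ‖v - u p‖ ^ 2)) *
        localMaxwellian 1 (θ p) (u p) v = 0) ∧
      (∀ p (k : Fin 3), ∫ v, ((∑ j : Fin 3, b p j * (v - u p) j) * G (p, ‖v - u p‖ ^ 2)) * v k *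
        localMaxwellian 1 (θ p) (u p) v = 0) ∧
      (∀ p, ∫ v, ((∑ j : Fin 3, b p j * (v - u p) j) * G (p, ‖v - u p‖ ^ 2)) * ‖v‖ ^ 2 *
        localMaxwellian 1 (θ p) (u p) v = 0)

/-- registered stub antecedent `KineticLDExplicitFamily` (S_E target) of line tail-rate, crux TransferEntropyClock
(stmt-AtomisticToContinuum-16625): the kinetic window LD along families with the tilt radius `β₁` chosen BEFORE the weights and the
bound asserted for `|β| ≤ β₁ / C`, `C` the quadratic-growth constant — route-internal, not a cited fact -/
def KineticLDExplicitFamily : Prop :=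
  ∃ η₀ : ℝ, 0 < η₀ ∧ ∀ (t₁ : ℝ) (a θ₀ : ℝ → T3 → ℝ) (u₀ : ℝ → T3 → V3),
    Continuous (Function.uncurry a) → Continuous (Function.uncurry θ₀) → Continuous (Function.uncurry u₀) →
    (∀ s x, 0 < a s x) → (∀ s x, 0 < θ₀ s x) →
    ∀ σ : ℝ, 0 < σ → (∀ s ∈ Set.Icc 0 t₁, σ ^ 3 * (⨆ x, a s x) ≤ η₀ * ∫ x, a s x) →
    ∀ Φ : (N : ℕ) → HardSphereFlow (Torus.geometry (Fin 3)) (hsDiameter σ N) (N + 1),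
    ∃ β₁ : ℝ, 0 < β₁ ∧
    ∀ (A : ℝ → T3 → Fin 3 → Fin 3 → ℝ) (b : ℝ → T3 → V3) (G : ℝ → T3 × ℝ → ℝ),
    Continuous (Function.uncurry A) → Continuous (Function.uncurry b) → Continuous (Function.uncurry G) →
    ∀ C : ℝ, 0 < C →
    (let F := fun (s : ℝ) (y : T3 × V3) =>
       (∑ j : Fin 3, ∑ k : Fin 3, A s y.1 j k * ((y.2 - u₀ s y.1) j * (y.2 - u₀ s y.1) k)) +
         (∑ j : Fin 3, b s y.1 j * (y.2 - u₀ s y.1) j) * G s (y.1, ‖y.2 - u₀ s y.1‖ ^ 2)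
     (∀ s ∈ Set.Icc 0 t₁, ∀ y : T3 × V3, |F s y| ≤ C * (1 + ‖y.2‖ ^ 2)) →
     (∀ s ∈ Set.Icc 0 t₁, ∀ x, ∫ v, F s (x, v) * localMaxwellian 1 (θ₀ s x) (u₀ s x) v = 0) →
     (∀ s ∈ Set.Icc 0 t₁, ∀ x (j : Fin 3),
        ∫ v, F s (x, v) * v j * localMaxwellian 1 (θ₀ s x) (u₀ s x) v = 0) →
     (∀ s ∈ Set.Icc 0 t₁, ∀ x, ∫ v, F s (x, v) * ‖v‖ ^ 2 * localMaxwellian 1 (θ₀ s x) (u₀ s x) v = 0) →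
     ∀ β : ℝ, |β| ≤ β₁ / C → ∀ ε : ℝ, 0 < ε → ∃ τ₀ : ℝ, 0 < τ₀ ∧ ∀ τ : ℝ, τ₀ ≤ τ →
     ∃ N₀ : ℕ, ∀ N : ℕ, N₀ ≤ N → ∀ s ∈ Set.Icc 0 t₁,
       ∫⁻ z, ENNReal.ofReal (Real.exp (β * ∑ i : Fin (N + 1),
           (τ * ((N : ℝ) + 1) ^ (-(1 / 3 : ℝ)))⁻¹ *
             ∫ r in (0 : ℝ)..(τ * ((N : ℝ) + 1) ^ (-(1 / 3 : ℝ))), F s ((Φ N).flow r z i)))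
         ∂(localGibbsLaw σ (a s) (u₀ s) (θ₀ s) N (Φ N)) ≤
       ENNReal.ofReal (Real.exp (ε * ((N : ℝ) + 1))))

/-- registered sub-goal signature `tailRate_explicitKineticInstance` of line tail-rate, crux TransferEntropyClock
(stmt-AtomisticToContinuum-16625): **KC1 with an explicit tilt law** — from the quantitative cut-off and the explicit kinetic family
node: along a reference family `(a, θ, u)` on the slab `[0, t₁] × 𝕋³` there are `κ > 0`, `Cg > 0` (before the level) and, for every
rate `A > 0`, an amplitude `Cρ ≥ 0` such that for every `K ≥ 1` the cut-off `G_K` is continuous on the slab, bounded on `s′ ≥ 0`, its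
remainder `s′ − 5θ − G_K` is `≤ Cρ e^{-AK}` below `K²` and `≤ |s′ − 5θ| + Cρ e^{-AK}` above, and the kinetic window LD bound for the
member "traceless stress + low heat flux with `G_K`" holds for all tilts `|β| ≤ κ/(Cg K)` — route-internal, not a cited fact -/
def ExplicitKineticInstance : Prop :=
  CutoffQuant → KineticLDExplicitFamily →
    ∃ ηK : ℝ, 0 < ηK ∧ ∀ (t₁ : ℝ) (a θ : ℝ → T3 → ℝ) (u : ℝ → T3 → V3), 0 ≤ t₁ →
    ContinuousOn (Function.uncurry a) (Set.Icc 0 t₁ ×ˢ Set.univ) → (∀ s ∈ Set.Icc 0 t₁, ∀ x, 0 < a s x) →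
    Torus.IsSmoothSpaceTimeOn (Set.Icc 0 t₁) θ → Torus.IsSmoothSpaceTimeOn (Set.Icc 0 t₁) u →
    (∀ s ∈ Set.Icc 0 t₁, ∀ x, 0 < θ s x) →
    ∀ σ : ℝ, 0 < σ → (∀ s ∈ Set.Icc 0 t₁, σ ^ 3 * (⨆ x, a s x) ≤ ηK * ∫ x, a s x) →
    ∀ Φ : (N : ℕ) → HardSphereFlow (Torus.geometry (Fin 3)) (hsDiameter σ N) (N + 1),
    ∃ κ : ℝ, 0 < κ ∧ ∃ Cg : ℝ, 0 < Cg ∧ ∀ A : ℝ, 0 < A → ∃ Cρ : ℝ, 0 ≤ Cρ ∧ ∀ K : ℝ, 1 ≤ K →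
    ∃ G : ℝ → T3 × ℝ → ℝ, ContinuousOn (Function.uncurry G) (Set.Icc 0 t₁ ×ˢ Set.univ) ∧
      (∃ C : ℝ, ∀ s ∈ Set.Icc 0 t₁, ∀ y : T3 × ℝ, 0 ≤ y.2 → |G s y| ≤ C) ∧
      (∀ s ∈ Set.Icc 0 t₁, ∀ (x : T3) (s' : ℝ), 0 ≤ s' → s' ≤ K ^ 2 →
        |s' - 5 * θ s x - G s (x, s')| ≤ Cρ * Real.exp (-(A * K))) ∧
      (∀ s ∈ Set.Icc 0 t₁, ∀ (x : T3) (s' : ℝ), K ^ 2 < s' →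
        |s' - 5 * θ s x - G s (x, s')| ≤ |s' - 5 * θ s x| + Cρ * Real.exp (-(A * K))) ∧
      ∀ β : ℝ, |β| ≤ κ / (Cg * K) → ∀ ε : ℝ, 0 < ε → ∃ τ₀ : ℝ, 0 < τ₀ ∧ ∀ τ : ℝ, τ₀ ≤ τ →
      ∃ N₀ : ℕ, ∀ N : ℕ, N₀ ≤ N → ∀ s ∈ Set.Icc 0 t₁,
        (let lo := fun (s : ℝ) (y : T3 × V3) =>
           (θ s y.1)⁻¹ * ∑ j : Fin 3, ∑ k : Fin 3,
               ((y.2 - u s y.1) j * (y.2 - u s y.1) k - (if j = k then ‖y.2 - u s y.1‖ ^ 2 / 3 else 0)) *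
                 Torus.partialDeriv k (fun x => u s x j) y.1 +
             (∑ k : Fin 3, Torus.partialDeriv k (θ s) y.1 / (2 * (θ s y.1) ^ 2) * (y.2 - u s y.1) k) *
               G s (y.1, ‖y.2 - u s y.1‖ ^ 2)
         ∫⁻ z, ENNReal.ofReal (Real.exp (β * ∑ i : Fin (N + 1),
             (τ * ((N : ℝ) + 1) ^ (-(1 / 3 : ℝ)))⁻¹ *
               ∫ r in (0 : ℝ)..(τ * ((N : ℝ) + 1) ^ (-(1 / 3 : ℝ))), lo s ((Φ N).flow r z i)))
           ∂(localGibbsLaw σ (a s) (u s) (θ s) N (Φ N)) ≤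
         ENNReal.ofReal (Real.exp (ε * ((N : ℝ) + 1))))

/-! ## §2 The sub-goal -/

-- adapted from Summits/.../OneFlightGossipEngineClampedCurrentsDockKineticInstance.lean (`stub_kineticInstance`): same clamp,
-- same class member, with the EXPLICIT node and the quantitative cut-off in place of KCWF and S11-family
/-- **`tailRate_explicitKineticInstance : ExplicitKineticInstance`** — clamp the family to the slab, build the clamped traceless
coefficients `Ac` and `bc = ∇θ/(2θ²)`, take `β₁` from the explicit node along the clamped family (BEFORE the weights), the cut-off
`G_K` of `CutoffQuant` over the parameter space `ℝ × 𝕋³`, the class constant `Cg K ≥ C_A + 2Bb(2+2U²)K + C₂`, and read the node's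
conclusion at `C := Cg K` on the slab (`traceless_form`). [folklore] -/
theorem tailRate_explicitKineticInstance : ExplicitKineticInstance := by
  intro hCut hK
  obtain ⟨η₀, hη₀, hKC⟩ := hK
  refine ⟨η₀, hη₀, ?_⟩
  intro t₁ a θ u ht₁ hac hapos hθ hu hθpos σ hσ hguard Φ
  -- (i) the clamp `p s = max 0 (min t₁ s)`
  obtain ⟨p, hp⟩ : ∃ p : ℝ → ℝ, p = fun s => max 0 (min t₁ s) := ⟨_, rfl⟩
  have hpc : Continuous p := by
    rw [hp]; exact continuous_const.max (continuous_const.min continuous_id)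
  have hpm : ∀ s, p s ∈ Icc 0 t₁ := fun s => by
    rw [hp]; exact ⟨le_max_left _ _, max_le ht₁ (min_le_left _ _)⟩
  have hpid : ∀ s ∈ Icc 0 t₁, p s = s := fun s hs => by
    rw [hp]; show max 0 (min t₁ s) = s; rw [min_eq_right hs.2, max_eq_right hs.1]
  -- slab continuity of the data and of their space derivatives
  have hθc0 : ContinuousOn (Function.uncurry θ) (Icc 0 t₁ ×ˢ univ) :=
    Torus.continuousOn_uncurry_of_continuousOn_stLift hθ.continuousOn_stLift
  have huc0 : ContinuousOn (Function.uncurry u) (Icc 0 t₁ ×ˢ univ) :=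
    Torus.continuousOn_uncurry_of_continuousOn_stLift hu.continuousOn_stLift
  have hDθ0 : ∀ k : Fin 3, ContinuousOn
      (Function.uncurry fun s x => Torus.partialDeriv k (θ s) x) (Icc 0 t₁ ×ˢ univ) :=
    fun k => continuousOn_partialDeriv_slab ht₁ hθ k
  have hDu0 : ∀ j k : Fin 3, ContinuousOn
      (Function.uncurry fun s x => Torus.partialDeriv k (fun y => u s y j) x) (Icc 0 t₁ ×ˢ univ) :=
    fun j k => continuousOn_partialDeriv_slab ht₁ (hu.apply j) k
  -- bounds on the slab
  obtain ⟨θm, hθm0, hθm⟩ := exists_pos_le_slab ht₁ hθc0 hθpos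
  obtain ⟨θM, hθM⟩ := exists_abs_le_slab hθc0
  obtain ⟨U, hU⟩ := hu.exists_norm_le_of_isCompact isCompact_Icc subset_rfl
  choose Mθ hMθ using fun k : Fin 3 => exists_abs_le_slab (hDθ0 k)
  choose Mu hMu using fun j k : Fin 3 => exists_abs_le_slab (hDu0 j k)
  obtain ⟨MD, hMD0, hMθ', hMu'⟩ : ∃ MD : ℝ, 0 ≤ MD ∧
      (∀ k, ∀ s ∈ Icc 0 t₁, ∀ x, |Torus.partialDeriv k (θ s) x| ≤ MD) ∧
      (∀ j k, ∀ s ∈ Icc 0 t₁, ∀ x, |Torus.partialDeriv k (fun y => u s y j) x| ≤ MD) := by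
    refine ⟨(∑ k, |Mθ k|) + ∑ j, ∑ k, |Mu j k|, by positivity, fun k s hs x => ?_,
      fun j k s hs x => ?_⟩
    · have h1 : |Mθ k| ≤ ∑ k, |Mθ k| :=
        Finset.single_le_sum (fun i _ => abs_nonneg (Mθ i)) (Finset.mem_univ k)
      have h2 : 0 ≤ ∑ j, ∑ k, |Mu j k| := by positivity
      linarith [hMθ k s hs x, le_abs_self (Mθ k)]
    · have h1 : |Mu j k| ≤ ∑ k, |Mu j k| :=
        Finset.single_le_sum (fun i _ => abs_nonneg (Mu j i)) (Finset.mem_univ k)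
      have h2 : ∑ k, |Mu j k| ≤ ∑ j, ∑ k, |Mu j k| :=
        Finset.single_le_sum (f := fun j => ∑ k, |Mu j k|)
          (fun i _ => Finset.sum_nonneg fun k _ => abs_nonneg (Mu i k)) (Finset.mem_univ j)
      have h3 : 0 ≤ ∑ k, |Mθ k| := by positivity
      linarith [hMu j k s hs x, le_abs_self (Mu j k)]
  -- the clamped families and the clamped coefficient families
  set θc : ℝ → T3 → ℝ := fun s x => θ (p s) x with hθc_def
  set uc : ℝ → T3 → V3 := fun s x => u (p s) x with huc_def
  set ac : ℝ → T3 → ℝ := fun s x => a (p s) x with hac_def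
  set Du : ℝ → T3 → Fin 3 → Fin 3 → ℝ :=
    fun s x j k => Torus.partialDeriv k (fun y => u (p s) y j) x with hDu_def
  set Dθ : ℝ → T3 → Fin 3 → ℝ := fun s x k => Torus.partialDeriv k (θ (p s)) x with hDθ_def
  set Ac : ℝ → T3 → Fin 3 → Fin 3 → ℝ := fun s x j k =>
    (θc s x)⁻¹ * (Du s x j k - if j = k then (∑ l, Du s x l l) / 3 else 0) with hAc_def
  set bc : ℝ → T3 → V3 := fun s x =>
    WithLp.toLp 2 fun k => Dθ s x k / (2 * θc s x ^ 2) with hbc_def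
  have hθc_pos : ∀ s x, 0 < θc s x := fun s x => hθpos (p s) (hpm s) x
  have hac_pos : ∀ s x, 0 < ac s x := fun s x => hapos (p s) (hpm s) x
  have hθm_c : ∀ s x, θm ≤ θc s x := fun s x => hθm (p s) (hpm s) x
  have hθM_c : ∀ s x, θc s x ≤ θM := fun s x => (abs_le.1 (hθM (p s) (hpm s) x)).2
  have hθM0 : 0 < θM := (hθc_pos 0 0).trans_le (hθM_c 0 0)
  have hU_c : ∀ s x, ‖uc s x‖ ≤ U := fun s x => hU (p s) (hpm s) x
  have hDθ_bd : ∀ s x k, |Dθ s x k| ≤ MD := fun s x k => hMθ' k (p s) (hpm s) x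
  have hDu_bd : ∀ s x j k, |Du s x j k| ≤ MD := fun s x j k => hMu' j k (p s) (hpm s) x
  -- continuity of the clamped families (global, jointly)
  have hθc_c : Continuous (Function.uncurry θc) := continuous_clamp hpc hpm hθc0
  have huc_c : Continuous (Function.uncurry uc) := continuous_clamp hpc hpm huc0
  have hac_c : Continuous (Function.uncurry ac) := continuous_clamp hpc hpm hac
  have hθc_c' : Continuous fun q : ℝ × T3 => θc q.1 q.2 := by
    simpa only [Function.uncurry_def] using hθc_c
  have hDθ_c : ∀ k, Continuous fun q : ℝ × T3 => Dθ q.1 q.2 k := fun k => by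
    simpa only [Function.uncurry_def] using continuous_clamp hpc hpm (hDθ0 k)
  have hDu_c : ∀ j k, Continuous fun q : ℝ × T3 => Du q.1 q.2 j k := fun j k => by
    simpa only [Function.uncurry_def] using continuous_clamp hpc hpm (hDu0 j k)
  have hθinv : Continuous fun q : ℝ × T3 => (θc q.1 q.2)⁻¹ :=
    hθc_c'.inv₀ fun q => (hθc_pos q.1 q.2).ne'
  have hAc_c : Continuous (Function.uncurry Ac) := by
    refine continuous_pi fun j => continuous_pi fun k => ?_
    simp only [Function.uncurry_def, hAc_def]
    refine hθinv.mul ((hDu_c j k).sub ?_)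
    split_ifs
    · exact (continuous_finsetSum _ fun l _ => hDu_c l l).div_const _
    · exact continuous_const
  have hbc_c : Continuous (Function.uncurry bc) := by
    have h : ∀ k, Continuous fun q : ℝ × T3 => Dθ q.1 q.2 k / (2 * θc q.1 q.2 ^ 2) := fun k =>
      (hDθ_c k).div (continuous_const.mul (hθc_c'.pow 2)) fun q =>
        (mul_pos two_pos (pow_pos (hθc_pos q.1 q.2) 2)).ne'
    simp only [Function.uncurry_def, hbc_def]
    exact (PiLp.continuous_toLp 2 _).comp (continuous_pi h)
  have hbc_c' : Continuous fun q : ℝ × T3 => bc q.1 q.2 := by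
    simpa only [Function.uncurry_def] using hbc_c
  -- bounds of the clamped coefficient families
  have hbc_bd : ∀ s x, ‖bc s x‖ ≤ 3 * (MD / (2 * θm ^ 2)) := fun s x => by
    refine norm_le_three_mul (bc s x) fun k => ?_
    show |Dθ s x k / (2 * θc s x ^ 2)| ≤ MD / (2 * θm ^ 2)
    rw [abs_div, abs_of_pos (mul_pos two_pos (pow_pos (hθc_pos s x) 2))]
    exact div_le_div₀ hMD0 (hDθ_bd s x k) (mul_pos two_pos (pow_pos hθm0 2))
      (mul_le_mul_of_nonneg_left (pow_le_pow_left₀ hθm0.le (hθm_c s x) 2) two_pos.le)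
  have hBb0 : 0 ≤ 3 * (MD / (2 * θm ^ 2)) := by positivity
  have hAc_bd : ∀ s x j k, |Ac s x j k| ≤ θm⁻¹ * (MD + MD) := by
    intro s x j k
    have hc : |(if j = k then (∑ l, Du s x l l) / 3 else 0 : ℝ)| ≤ MD := by
      split_ifs
      · rw [abs_div, abs_of_pos (by norm_num : (0 : ℝ) < 3), Fin.sum_univ_three]
        have h0 := hDu_bd s x 0 0
        have h1 := hDu_bd s x 1 1
        have h2 := hDu_bd s x 2 2
        have h3 := abs_add_three (Du s x 0 0) (Du s x 1 1) (Du s x 2 2)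
        linarith
      · rw [abs_zero]; exact hMD0
    show |(θc s x)⁻¹ * (Du s x j k - if j = k then (∑ l, Du s x l l) / 3 else 0)| ≤ _
    rw [abs_mul, abs_inv, abs_of_pos (hθc_pos s x)]
    exact mul_le_mul (inv_anti₀ hθm0 (hθm_c s x))
      ((abs_sub _ _).trans (add_le_add (hDu_bd s x j k) hc)) (abs_nonneg _)
      (inv_nonneg.2 hθm0.le)
  have htr : ∀ s x, ∑ j, Ac s x j j = 0 := fun s x => trace_free (θc s x)⁻¹ (Du s x)
  have hMA0 : 0 ≤ θm⁻¹ * (MD + MD) := mul_nonneg (inv_nonneg.2 hθm0.le) (by linarith)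
  have hguard_c : ∀ s ∈ Icc 0 t₁, σ ^ 3 * (⨆ x, ac s x) ≤ η₀ * ∫ x, ac s x := fun s hs => by
    simp only [hac_def, hpid s hs]; exact hguard s hs
  -- (ii) the explicit node along the clamped families: the tilt radius `β₁` BEFORE the weights
  obtain ⟨β₁, hβ₁, hβ⟩ := hKC t₁ ac θc uc hac_c hθc_c huc_c hac_pos hθc_pos σ hσ hguard_c Φ
  -- (iii) the quantitative cut-off along the clamped families (parameter space `ℝ × 𝕋³`)
  obtain ⟨C₂, hC₂, HA⟩ := @hCut (ℝ × T3) _ _ (fun q => θc q.1 q.2) hθc_c' (fun q => uc q.1 q.2) (fun q => bc q.1 q.2) θM U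
    (3 * (MD / (2 * θm ^ 2))) (fun q => hθc_pos q.1 q.2) hθM0 (fun q => hθM_c q.1 q.2) (fun q => hU_c q.1 q.2) hBb0
    (fun q => hbc_bd q.1 q.2)
  set CA : ℝ := 9 * (θm⁻¹ * (MD + MD)) * (2 + 2 * U ^ 2) with hCA
  have hCA0 : 0 ≤ CA := by positivity
  set Cg : ℝ := CA + 2 * (3 * (MD / (2 * θm ^ 2))) * (2 + 2 * U ^ 2) + C₂ + 1 with hCg_def
  have hCg : 0 < Cg := by positivity
  refine ⟨β₁, hβ₁, Cg, hCg, fun A hA => ?_⟩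
  obtain ⟨Cρ, hCρ, HKq⟩ := HA A hA
  refine ⟨Cρ, hCρ, fun K hK1 => ?_⟩
  have hK0 : 0 ≤ K := zero_le_one.trans hK1
  obtain ⟨G', hG'c, ⟨CG, hCG⟩, hr1, hr2, hgrowth, hO0, hO1, hO2⟩ := HKq K hK1
  obtain ⟨G, hG⟩ : ∃ G : ℝ → T3 × ℝ → ℝ, G = fun s y => G' ((s, y.1), y.2) := ⟨_, rfl⟩
  have hGe : ∀ s x r, G s (x, r) = G' ((s, x), r) := fun s x r => by rw [hG]
  have hGc : Continuous (Function.uncurry G) := by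
    rw [hG]
    show Continuous fun q : ℝ × (T3 × ℝ) => G' ((q.1, q.2.1), q.2.2)
    fun_prop
  have hGsx : ∀ (s : ℝ) (x : T3), Continuous fun r : ℝ => G s (x, r) := fun s x =>
    hGc.comp (continuous_const.prodMk (continuous_const.prodMk continuous_id))
  -- (iv) the class hypotheses of the node for the member `Σ Ac w w + (bc·w) G`, with constant `Cg K`
  have hCgK : CA + (2 * (3 * (MD / (2 * θm ^ 2))) * (2 + 2 * U ^ 2) * K + C₂) ≤ Cg * K := by
    rw [hCg_def]
    nlinarith [mul_nonneg hCA0 (sub_nonneg.2 hK1), mul_nonneg hC₂ (sub_nonneg.2 hK1)]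
  have hCF : ∀ (s : ℝ) (x : T3) (v : V3),
      |(∑ j, bc s x j * (v - uc s x) j) * G s (x, ‖v - uc s x‖ ^ 2)| ≤
        (2 * (3 * (MD / (2 * θm ^ 2))) * (2 + 2 * U ^ 2) * K + C₂) * (1 + ‖v‖ ^ 2) := fun s x v => by
    rw [hGe]; exact hgrowth (s, x) v
  have hCB : ∀ (s : ℝ) (x : T3) (v : V3),
      |(∑ j, ∑ k, Ac s x j k * ((v - uc s x) j * (v - uc s x) k)) +
        (∑ j, bc s x j * (v - uc s x) j) * G s (x, ‖v - uc s x‖ ^ 2)| ≤ Cg * K * (1 + ‖v‖ ^ 2) := by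
    intro s x v
    refine (abs_add_le _ _).trans ?_
    have h2 := hCF s x v
    have hS : ∑ j, ∑ k, |Ac s x j k| ≤ 9 * (θm⁻¹ * (MD + MD)) := by
      calc ∑ j, ∑ k, |Ac s x j k| ≤ ∑ j : Fin 3, ∑ k : Fin 3, θm⁻¹ * (MD + MD) :=
            Finset.sum_le_sum fun j _ => Finset.sum_le_sum fun k _ => hAc_bd s x j k
        _ = 9 * (θm⁻¹ * (MD + MD)) := by simp only [Fin.sum_univ_three]; ring
    have hu2 : 2 + 2 * ‖uc s x‖ ^ 2 ≤ 2 + 2 * U ^ 2 := by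
      nlinarith [hU_c s x, norm_nonneg (uc s x)]
    have hv : 0 ≤ 1 + ‖v‖ ^ 2 := by positivity
    have hq : |∑ j, ∑ k, Ac s x j k * ((v - uc s x) j * (v - uc s x) k)| ≤ CA * (1 + ‖v‖ ^ 2) :=
      calc _ ≤ (∑ j, ∑ k, |Ac s x j k|) * (2 + 2 * ‖uc s x‖ ^ 2) * (1 + ‖v‖ ^ 2) :=
            quad_growth (uc s x) (Ac s x) v
        _ ≤ 9 * (θm⁻¹ * (MD + MD)) * (2 + 2 * ‖uc s x‖ ^ 2) * (1 + ‖v‖ ^ 2) :=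
            mul_le_mul_of_nonneg_right (mul_le_mul_of_nonneg_right hS (by positivity)) hv
        _ ≤ 9 * (θm⁻¹ * (MD + MD)) * (2 + 2 * U ^ 2) * (1 + ‖v‖ ^ 2) :=
            mul_le_mul_of_nonneg_right (mul_le_mul_of_nonneg_left hu2 (by positivity)) hv
    have h3 := mul_le_mul_of_nonneg_right hCgK hv
    linarith
  have hOrth : ∀ (s : ℝ) (x : T3),
      (∫ v, ((∑ j, ∑ k, Ac s x j k * ((v - uc s x) j * (v - uc s x) k)) +
          (∑ j, bc s x j * (v - uc s x) j) * G s (x, ‖v - uc s x‖ ^ 2)) *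
          localMaxwellian 1 (θc s x) (uc s x) v = 0) ∧
      (∀ k, ∫ v, ((∑ j, ∑ k, Ac s x j k * ((v - uc s x) j * (v - uc s x) k)) +
          (∑ j, bc s x j * (v - uc s x) j) * G s (x, ‖v - uc s x‖ ^ 2)) * v k *
          localMaxwellian 1 (θc s x) (uc s x) v = 0) ∧
      ∫ v, ((∑ j, ∑ k, Ac s x j k * ((v - uc s x) j * (v - uc s x) k)) +
          (∑ j, bc s x j * (v - uc s x) j) * G s (x, ‖v - uc s x‖ ^ 2)) * ‖v‖ ^ 2 *
          localMaxwellian 1 (θc s x) (uc s x) v = 0 := by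
    intro s x
    have h0 : ∫ v, ((∑ j, bc s x j * (v - uc s x) j) * G s (x, ‖v - uc s x‖ ^ 2)) *
        localMaxwellian 1 (θc s x) (uc s x) v = 0 := by simp_rw [hGe]; exact hO0 (s, x)
    have h1 : ∀ k, ∫ v, ((∑ j, bc s x j * (v - uc s x) j) * G s (x, ‖v - uc s x‖ ^ 2)) * v k *
        localMaxwellian 1 (θc s x) (uc s x) v = 0 := fun k => by simp_rw [hGe]; exact hO1 (s, x) k
    have h2 : ∫ v, ((∑ j, bc s x j * (v - uc s x) j) * G s (x, ‖v - uc s x‖ ^ 2)) * ‖v‖ ^ 2 *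
        localMaxwellian 1 (θc s x) (uc s x) v = 0 := by simp_rw [hGe]; exact hO2 (s, x)
    exact member_orth (hθc_pos s x) (uc s x) (A := Ac s x) (htr s x) (bc s x)
      (Gx := fun r => G s (x, r)) (hGsx s x) (CF := _) (fun v => hCF s x v) h0 h1 h2
  -- (v) the node's conclusion for this member at the constant `Cg K`
  have hnode := hβ Ac bc G hAc_c hbc_c hGc (Cg * K) (by positivity) (fun s _ y => hCB s y.1 y.2)
    (fun s _ x => (hOrth s x).1) (fun s _ x j => (hOrth s x).2.1 j) (fun s _ x => (hOrth s x).2.2)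
  refine ⟨G, hGc.continuousOn, ⟨CG, fun s _ y hy => ?_⟩, fun s hs x s' hs0 hsK => ?_, fun s hs x s' hsK => ?_,
    fun β hββ ε hε => ?_⟩
  · rw [show G s y = G' ((s, y.1), y.2) by rw [hG]]
    exact hCG ((s, y.1), y.2) hy
  · have h := hr1 (s, x) s' hs0 hsK
    simp only [hθc_def, hpid s hs] at h
    rw [hGe]; exact h
  · have h := hr2 (s, x) s' hsK
    simp only [hθc_def, hpid s hs] at h
    rw [hGe]; exact h
  · obtain ⟨τ₀, hτ₀, hτ⟩ := hnode β hββ ε hε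
    refine ⟨τ₀, hτ₀, fun τ hττ => ?_⟩
    obtain ⟨N₀, hN⟩ := hτ τ hττ
    refine ⟨N₀, fun N hNN s hs => ?_⟩
    have hfin := hN N hNN s hs
    simpa only [hac_def, hθc_def, huc_def, hAc_def, hbc_def, hDu_def, hDθ_def, hpid s hs,
      PiLp.toLp_apply, traceless_form] using hfin
end Summit.AtomisticToContinuum.HydrodynamicLimit.Theorems.TransferEntropyClockTailRateKinetic

end
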